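import Summits.QuantumFields.YangMills.Theorems.ComplexCouplingChannelTubeZeroFreeChannelEngineChain
import Literature.MathematicalPhysics.QuantumFieldTheory.WilsonTransferKernel
import HarnessLib

/-!
# `TubeZeroFreeChannel` forces an `L`-uniform real transfer-matrix gap (the route's engine, run forward)

Crux `TubeZeroFreeChannel` (item stmt-QuantumFields-18841, route `ComplexCouplingChannel` of
`QuantumFields/YangMills`), strategist certificate, file 3 of 3: **the crux, together with the PROVED
strong-coupling anchor (item 18843, in its in-proof form `exists_holomorphic_tube_rate` of part 1), implies for
every compact simple gauge group `G`, every faithful lattice representation `r` and every large real coupling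
`β` an `L`-UNIFORM spectral gap of the periodic-box transfer matrix**:
`∃ θ ∈ (0,1) ∃ L₀ ∀ L ≥ L₀ ∃ C_L ∀ m, traceExcess r.ρ β L m ≤ C_L θ^m` (`uniformRealGap_of_tubeZeroFreeChannel`;
`traceExcess = Σ_{i ≥ 1} (λᵢ/λ₊)^m`, so `λ₁/λ₊ ≤ θ` for all `L ≥ L₀`).  This is the volume-uniform lattice mass
gap in transfer-matrix form — the open lattice core of the summit for `SU(N)`, and physically FALSE (light
't Hooft fluxes) for centreless `G` — which is why the crux is summit-strength (see the crux's
`STRATEGY-CENSUS-r1.md`).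

* `traceExcess_le_of_pinning`: at real `β ≥ 0`, `Zc_t(β) = Σᵢ λᵢ^t` (trace formula,
  `exists_spectralData_wilsonFinTorusPartition`), so exponential pinning `‖Zc_t(β) e^{−tE} − 1‖ ≤ C' e^{−κt}`
  forces `|e^E| = λ₊` (squeeze `λ₊^{m+2} ≤ Z_{m+2} ≤ λ₊^m Σλ²`) and `traceExcess ≤ C e^{−κ m}`.
* `uniformRealGap_of_tubeZeroFreeChannel`: the crux gives, for `β ≥ β₁` and `ρ = ρ₀/2`, a zero-free channel
  `D ∋ β` meeting the anchor disc; part 2's `exists_rate_pinning_of_zeroFree` (with `θ` fixed by `D` BEFORE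
  `L`) and part 1's anchor at each `L ≥ max L₀ 1` give the pinning at `β`, and `traceExcess_le_of_pinning`
  converts it into the gap with `θ' = e^{−θ/8}` independent of `L`.

References: K. Osterwalder, E. Seiler, Ann. Phys. 110 (1978) §3; E. Seiler, LNP 159 (1982) Ch. 3.
-/

set_option autoImplicit false

noncomputable section

open scoped Topology
open Filter Metric Set Complex MeasureTheory
open Literature.MathematicalPhysics.QuantumFieldTheory
open Literature.Probability.LatticeModels
open Summit.QuantumFields.YangMills.Theorems.TubeZeroFreeChannel.Negative (boxZ boxZ_eq_partZ differentiable_boxZ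
  norm_boxZ_le)
open Summit.QuantumFields.YangMills.Theses.ComplexCouplingChannel (TubeZeroFreeChannel)

namespace Summit.QuantumFields.YangMills.Theorems.TubeZeroFreeChannel

/-! ### E3. Real coupling: pinning of `Zc(β)` forces the uniform gap -/

section Real

variable {G : Type} [Group G] [TopologicalSpace G] [IsTopologicalGroup G] [CompactSpace G]
  [MeasurableSpace G] [BorelSpace G]

/-- **Exponential pinning at a real coupling is a ratio gap.** If at a real `β ≥ 0` the box partition functions
`Zc(β; L, t)` are pinned to a rate, `‖Zc(β;L,t) e^{−tE} − 1‖ ≤ C' e^{−κ t}` for `t ≥ T`, then `|e^E| = λ₊(β, L)` and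
`traceExcess r.ρ β L m ≤ C (e^{−κ})^m` for all `m ≥ 1` (trace formula `Zc = Σ λᵢ^t` and the squeeze
`λ₊^{m+2} ≤ Zc ≤ λ₊^m Σλᵢ²`). [folklore] -/
theorem traceExcess_le_of_pinning (r : LatticeRep G) {β : ℝ} (hβ : 0 ≤ β) (L : ℕ) [NeZero L] {E : ℂ}
    {C' κ : ℝ} (hκ : 0 < κ) {T : ℕ}
    (h : ∀ t : ℕ, T ≤ t → ‖boxZ r (β : ℂ) L t * exp (-((t : ℂ) * E)) - 1‖ ≤ C' * Real.exp (-(κ * t))) :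
    ∃ C : ℝ, ∀ (m : ℕ) [NeZero m], traceExcess r.ρ β L m ≤ C * Real.exp (-κ) ^ m := by
  haveI : SecondCountableTopology G :=
    (r.continuous.isClosedEmbedding r.injective).isEmbedding.secondCountableTopology
  obtain ⟨s, _, b, lam, i₀, -, hle, hL0, -, hS, hrad, hZ⟩ :=
    exists_spectralData_wilsonFinTorusPartition r.continuous r.mem_unitary hβ L
  -- notation
  set lamT : ℝ := lam i₀ with hlamT
  set Λ : ℝ := Real.exp E.re with hΛ
  have hΛ0 : 0 < Λ := Real.exp_pos _
  set Z : ℕ → ℝ := fun t => wilsonFinTorusPartition r.ρ β L L L t with hZdef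
  set θ' : ℝ := Real.exp (-κ) with hθ'
  have hθ'0 : 0 < θ' := Real.exp_pos _
  have hθ'pow : ∀ t : ℕ, Real.exp (-(κ * t)) = θ' ^ t := fun t => by
    rw [hθ', ← Real.exp_nat_mul]; ring_nf
  -- Step 1: the pinning in real terms
  have hpin : ∀ t : ℕ, T ≤ t → |Z t / Λ ^ t - 1| ≤ C' * θ' ^ t := by
    intro t ht
    have h1 := h t ht
    have hnorm : ‖boxZ r (β : ℂ) L t * exp (-((t : ℂ) * E))‖ = Z t / Λ ^ t := by
      rw [norm_mul, norm_boxZ_ofReal, Complex.norm_exp, hΛ, ← Real.exp_nat_mul, div_eq_mul_inv,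
        ← Real.exp_neg]
      congr 2
      simp [Complex.mul_re]
    have h2 := abs_norm_sub_norm_le (boxZ r (β : ℂ) L t * exp (-((t : ℂ) * E))) 1
    rw [hnorm, norm_one] at h2
    rw [← hθ'pow]
    exact h2.trans h1
  have hC'0 : 0 ≤ C' := by
    have h1 := hpin T le_rfl
    have h2 : 0 ≤ C' * θ' ^ T := (abs_nonneg _).trans h1
    exact nonneg_of_mul_nonneg_left h2 (pow_pos hθ'0 T) |> fun h => by
      by_contra hc; push Not at hc; nlinarith [pow_pos hθ'0 T]
  -- Step 2: the two-sided spectral bounds `lamT^{m+2} ≤ Z (m+2) ≤ lamT^m S₂`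
  set S₂ : ℝ := ∑' i, lam i ^ 2 with hS₂
  have hS2 : HasSum (fun i => lam i ^ 2) S₂ := hS.hasSum
  have hlow : ∀ m : ℕ, lamT ^ (m + 2) ≤ Z (m + 2) := fun m =>
    le_hasSum (hZ m) i₀ fun j _ => pow_nonneg (hle j).1 _
  have hup : ∀ m : ℕ, Z (m + 2) ≤ lamT ^ m * S₂ := by
    intro m
    refine hasSum_le (fun i => ?_) (hZ m) (hS2.mul_left (lamT ^ m))
    rw [pow_add]
    exact mul_le_mul_of_nonneg_right (pow_le_pow_left₀ (hle i).1 (hle i).2 m) (sq_nonneg _)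
  have hS20 : 0 < S₂ := lt_of_lt_of_le (by positivity) (le_hasSum hS2 i₀ fun j _ => sq_nonneg _)
  -- Step 3: `lamT = Λ`
  set q : ℝ := lamT / Λ with hq
  have hq0 : 0 < q := div_pos hL0 hΛ0
  have hqpow : ∀ t : ℕ, q ^ t = lamT ^ t / Λ ^ t := fun t => by rw [hq, div_pow]
  have hq_le : q ≤ 1 := by
    by_contra hq1
    push Not at hq1
    have hev1 : ∀ᶠ n : ℕ in atTop, 1 + C' < q ^ n :=
      (tendsto_pow_atTop_atTop_of_one_lt hq1).eventually_gt_atTop _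
    have hev2 : ∀ᶠ n : ℕ in atTop, T + 2 ≤ n := eventually_ge_atTop _
    obtain ⟨n, hn1, hn2⟩ := (hev1.and hev2).exists
    obtain ⟨m, rfl⟩ : ∃ m, n = m + 2 := ⟨n - 2, by omega⟩
    have h1 := hpin (m + 2) (by omega)
    have h2 : Z (m + 2) / Λ ^ (m + 2) ≤ 1 + C' := by
      have := (abs_le.1 h1).2
      have hθ1 : θ' ^ (m + 2) ≤ 1 := pow_le_one₀ hθ'0.le (by
        rw [hθ']; exact Real.exp_le_one_iff.2 (by linarith))
      nlinarith
    have h3 : q ^ (m + 2) ≤ Z (m + 2) / Λ ^ (m + 2) := by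
      rw [hqpow]
      exact div_le_div_of_nonneg_right (hlow m) (pow_nonneg hΛ0.le _)
    linarith
  have hq_ge : 1 ≤ q := by
    by_contra hq1
    push Not at hq1
    have hev1 : ∀ᶠ m : ℕ in atTop, q ^ m * (S₂ / Λ ^ 2) < 1 / 2 := by
      have ht : Tendsto (fun m : ℕ => q ^ m * (S₂ / Λ ^ 2)) atTop (𝓝 (0 * (S₂ / Λ ^ 2))) :=
        (tendsto_pow_atTop_nhds_zero_of_lt_one hq0.le hq1).mul_const _
      rw [zero_mul] at ht
      exact ht.eventually_lt_const (by norm_num)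
    have hev2 : ∀ᶠ m : ℕ in atTop, C' * θ' ^ (m + 2) ≤ 1 / 2 := by
      have ht : Tendsto (fun m : ℕ => C' * θ' ^ (m + 2)) atTop (𝓝 (C' * 0)) := by
        refine (Tendsto.const_mul C' ?_)
        have hθ'1 : θ' < 1 := by
          have hh := Real.exp_lt_exp.2 (neg_lt_zero.2 hκ)
          rwa [Real.exp_zero] at hh
        have h0 := tendsto_pow_atTop_nhds_zero_of_lt_one hθ'0.le hθ'1
        have h0' : Tendsto (fun m : ℕ => θ' ^ (m + 2)) atTop (𝓝 0) :=
          h0.comp (tendsto_add_atTop_nat 2)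
        exact h0'
      rw [mul_zero] at ht
      exact ht.eventually_le_const (by norm_num)
    have hev3 : ∀ᶠ m : ℕ in atTop, T ≤ m + 2 := by
      filter_upwards [eventually_ge_atTop T] with m hm; omega
    obtain ⟨m, hm1, hm2, hm3⟩ := (hev1.and (hev2.and hev3)).exists
    have h1 := hpin (m + 2) hm3
    have h2 : 1 / 2 ≤ Z (m + 2) / Λ ^ (m + 2) := by
      have := (abs_le.1 h1).1
      linarith
    have h3 : Z (m + 2) / Λ ^ (m + 2) ≤ q ^ m * (S₂ / Λ ^ 2) := by
      rw [hqpow, pow_add, div_mul_div_comm, ← mul_comm]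
      exact div_le_div_of_nonneg_right (hup m) (by positivity)
    linarith
  have hqq : lamT = Λ := by
    have : q = 1 := le_antisymm hq_le hq_ge
    rw [hq, div_eq_one_iff_eq hΛ0.ne'] at this
    exact this
  -- Step 4: `traceExcess = Z/Λ^m - 1`
  set X : ℕ → ℝ := fun m => Z m / Λ ^ m - 1 with hX
  have hXeq : ∀ (m : ℕ) [NeZero m], traceExcess r.ρ β L m = X m := by
    intro m _
    rw [hX]
    simp only
    rw [traceExcess, ← wilsonFinTorusPartition_eq_cyclicPartition r.continuous r.mem_unitary β L m, hrad, hqq]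
  -- Step 5: the constant
  refine ⟨C' + ∑ k ∈ Finset.range T, |X k| / θ' ^ k, fun m _ => ?_⟩
  have hsum0 : 0 ≤ ∑ k ∈ Finset.range T, |X k| / θ' ^ k :=
    Finset.sum_nonneg fun k _ => div_nonneg (abs_nonneg _) (pow_nonneg hθ'0.le _)
  rw [hXeq m]
  rcases le_or_gt T m with hTm | hTm
  · have h1 : X m ≤ C' * θ' ^ m := by
      have := (abs_le.1 (hpin m hTm)).2
      rw [hX]; linarith
    calc X m ≤ C' * θ' ^ m := h1
      _ ≤ (C' + ∑ k ∈ Finset.range T, |X k| / θ' ^ k) * θ' ^ m := by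
          gcongr
          linarith
  · have hmem : m ∈ Finset.range T := Finset.mem_range.2 hTm
    have h1 : |X m| / θ' ^ m ≤ ∑ k ∈ Finset.range T, |X k| / θ' ^ k :=
      Finset.single_le_sum (f := fun k => |X k| / θ' ^ k)
        (fun k _ => div_nonneg (abs_nonneg _) (pow_nonneg hθ'0.le _)) hmem
    have hθm : 0 < θ' ^ m := pow_pos hθ'0 _
    calc X m ≤ |X m| := le_abs_self _
      _ = |X m| / θ' ^ m * θ' ^ m := by field_simp
      _ ≤ (C' + ∑ k ∈ Finset.range T, |X k| / θ' ^ k) * θ' ^ m := by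
          gcongr
          linarith

end Real

/-! ### The certificate -/

/-- **`TubeZeroFreeChannel` forces the `L`-uniform real transfer-matrix gap** (`∃ θ < 1 ∃ L₀ ∀ L ≥ L₀ ∃ C ∀ m,
traceExcess r.ρ β L m ≤ C θ^m` at every `β ≥ β₁`). For every compact simple `G`, every lattice representation
`r` and every `β ≥ max β₁ 0` (with `β₁` from the crux): the crux's zero-free channel `D ∋ β` reaching the real
anchor point `x`, `|x| < ρ₀/2`, of the strong-coupling disc carries the anchor's exponential rate pinning to `β`
(`exists_rate_pinning_of_zeroFree`, exponent `θ_D` fixed BEFORE `L` is chosen), and at real `β` pinning is the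
`L`-uniform ratio gap `traceExcess ≤ C_L e^{−θ_D m/32}` (`traceExcess_le_of_pinning`). -/
theorem uniformRealGap_of_tubeZeroFreeChannel (hT : TubeZeroFreeChannel) :
    ∀ (G : Type) [Group G] [TopologicalSpace G] [IsTopologicalGroup G] [CompactSpace G]
      [MeasurableSpace G] [BorelSpace G], IsCompactSimpleLieGroup G → ∀ r : LatticeRep G,
      ∃ β₁ : ℝ, ∀ β : ℝ, β₁ ≤ β →
        ∃ θ : ℝ, 0 < θ ∧ θ < 1 ∧ ∃ L₀ : ℕ, ∀ (L : ℕ) [NeZero L], L₀ ≤ L → ∃ C : ℝ, ∀ (m : ℕ) [NeZero m],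
          traceExcess r.ρ β L m ≤ C * θ ^ m := by
  intro G _ _ _ _ _ _ hG r
  obtain ⟨ρ₀, hρ₀, hanchor⟩ := exists_holomorphic_tube_rate (G := G) r
  obtain ⟨β₁, hβ₁⟩ := hT G hG r
  refine ⟨max β₁ 0, fun β hβ => ?_⟩
  have hββ₁ : β₁ ≤ β := le_trans (le_max_left _ _) hβ
  have hβ0 : 0 ≤ β := le_trans (le_max_right _ _) hβ
  obtain ⟨D, hDo, hDc, hβD, ⟨x, hxρ, hxD⟩, L₀, hzf⟩ := hβ₁ β hββ₁ (ρ₀ / 2) (by positivity)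
  -- the exponent of the channel, fixed before `L`
  obtain ⟨θ, hθ0, hθ1, hengine⟩ := exists_rate_pinning_of_zeroFree hDo hDc.isPreconnected hxD hβD
    (r₀ := ρ₀ / 2) (by positivity)
  have hsub : ball (x : ℂ) (ρ₀ / 2) ⊆ ball (0 : ℂ) ρ₀ := by
    intro z hz
    rw [mem_ball, dist_zero_right] 
    rw [mem_ball] at hz
    have hxn : ‖(x : ℂ)‖ < ρ₀ / 2 := by rw [Complex.norm_real, Real.norm_eq_abs]; exact hxρ
    calc ‖z‖ = ‖(z - x) + x‖ := by ring_nf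
      _ ≤ ‖z - (x : ℂ)‖ + ‖(x : ℂ)‖ := norm_add_le _ _
      _ < ρ₀ / 2 + ρ₀ / 2 := add_lt_add (by rwa [← dist_eq_norm]) hxn
      _ = ρ₀ := by ring
  refine ⟨Real.exp (-(1 / 4 * θ / 2)), Real.exp_pos _, ?_, max L₀ 1, fun L _ hL => ?_⟩
  · have : 0 < 1 / 4 * θ / 2 := by positivity
    have h := Real.exp_lt_exp.2 (neg_lt_zero.2 this)
    rwa [Real.exp_zero] at h
  have hL₀ : L₀ ≤ L := le_trans (le_max_left _ _) hL
  have hL1 : 1 ≤ L := le_trans (le_max_right _ _) hL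
  obtain ⟨t₀, ht₀⟩ := hzf L hL₀
  obtain ⟨K, e, he, ℓ, hℓ⟩ := hanchor L hL1
  -- run the engine at this `L`
  have hA : 0 ≤ 6 * (L : ℝ) ^ 3 * costBound r.ρ := by
    have := (costBound_pos r.ρ).le
    positivity
  obtain ⟨E, C', T, hpin⟩ := hengine (fun t z => boxZ r z L t) ℓ e (max t₀ 1)
    (6 * (L : ℝ) ^ 3 * costBound r.ρ) K (1 / 4) (le_max_right _ _) hA (by norm_num)
    (fun t => differentiable_boxZ r L t)
    (fun t ht z hz => ht₀ t (le_trans (le_max_left _ _) ht) z hz)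
    (fun t _ z => by
      refine (norm_boxZ_le r z L t).trans (le_of_eq ?_)
      congr 1; ring)
    (he.mono hsub)
    (fun t ht => (hℓ t (le_trans (le_max_right _ _) ht)).1.mono hsub)
    (fun t ht z hz => ((hℓ t (le_trans (le_max_right _ _) ht)).2 z (hsub hz)).1)
    (fun t ht z hz => by
      exact ((hℓ t (le_trans (le_max_right _ _) ht)).2 z (hsub hz)).2)
  have hκ : 0 < 1 / 4 * θ / 2 := by positivity
  exact traceExcess_le_of_pinning r hβ0 L hκ hpin


end Summit.QuantumFields.YangMills.Theorems.TubeZeroFreeChannel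

end
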